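import Summits.NavierStokesRegularity.NavierStokesRegularity.Theorems.WakeRatchetEternalViscousRateStubNormalise
import Summits.NavierStokesRegularity.NavierStokesRegularity.Theorems.WakeRatchetEternalViscousRateDissipativeRung

/-!
# Dissipation edge (crux `WakeRatchet.EternalViscousRate`, ⟨stmt-NavierStokesRegularity-25647⟩) —
# the open stub `stub_inertial` NORMALISED IN THE VISCOSITY: the slice `ν̂ = 1` is the whole statement

Helper for the registered skeleton «dissipation edge» (LINE g9-2, sha16 842b13749eff, namespace `…Cruxes.EternalViscousRate.DissipationEdge`;
`stub_normalise` landed, `stub_inertial` open).  The skeleton's docstring asserts that the rate statement has ONE scale-free parameter, the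
dissipation number `𝔇 = M/ν̂²`, because log-time translation `σ ↦ σ + h` maps `(ν̂, M) ↦ (e^h ν̂, e^{2h} M)` (tree: `IsEternalVisc.translate`)
while `edgeThreshold ∝ ν̂²`.  This file makes that precise for the INERTIAL-REGIME rate statement (the body of `StubInertial` after its
`R, a, εs, ε₀, α` prefix, written out with the tree's `edgeThreshold`):
* `physEnergy_translate`, `tail_translate` — physical energies / tails of the translated solution `σ ↦ W(σ − h)` are `e^{2h}` times those of
  `W` at `σ − h`;
* `inertialRateAt_of_one` — if the inertial-regime rate bound with rate `a` holds at covariant viscosity `ν̂ = 1` (for all bounded admissible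
  eternal solutions and all tail bounds `M > edgeThreshold α 1`), then it holds at EVERY `ν̂ > 0` (translate by `h = −log ν̂`).
So `stub_inertial` may be attacked at `ν̂ = 1` without loss; conversely a counterexample at any `ν̂ > 0` is one at `ν̂ = 1`.  MODEL lattice only
(Tao 2016 §4, §6.4); nothing here is a statement about the Navier–Stokes equations; no stub is closed by name; no summit is proved.
[cite: Tao2016AveragedNS, §4 (the viscous equation before Thm. 4.2; scaling), §6.4; cell vocabulary (`IsEternalVisc.translate`)]
-/

noncomputable section

set_option linter.dupNamespace false

namespace Summit.NavierStokesRegularity.NavierStokesRegularity.Cruxes.EternalViscousRate.DissipationEdge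

open Set Filter Topology
open Literature.Analysis.FluidPDE Literature.Analysis.FluidPDE.TaoCascade

variable {m : ℕ} {ε₀ : ℝ}

/-- Physical energies of the log-time translate `σ ↦ W(σ − h)`: `E^{W(·−h)}_k(σ) = e^{2h} · E^{W}_k(σ − h)`. -/
theorem physEnergy_translate (W : ℤ → ℝ → Em m) (h : ℝ) (k : ℤ) (σ : ℝ) :
    physEnergy ε₀ (fun n τ => W n (τ - h)) k σ = Real.exp (2 * h) * physEnergy ε₀ W k (σ - h) := by
  unfold physEnergy
  have he : Real.exp (2 * σ) = Real.exp (2 * h) * Real.exp (2 * (σ - h)) := by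
    rw [← Real.exp_add]; ring_nf
  rw [he]; ring

/-- Tails of the translate: `Σ_k E^{W(·−h)}_{n+k}(σ) = e^{2h} · Σ_k E^{W}_{n+k}(σ − h)`. -/
theorem tail_translate (W : ℤ → ℝ → Em m) (h : ℝ) (n : ℤ) (σ : ℝ) :
    ∑' k : ℕ, physEnergy ε₀ (fun n τ => W n (τ - h)) (n + k) σ
      = Real.exp (2 * h) * ∑' k : ℕ, physEnergy ε₀ W (n + k) (σ - h) := by
  rw [← tsum_mul_left]
  exact tsum_congr fun k => physEnergy_translate W h (n + k) σ

/-- `edgeThreshold` scales like `ν̂²`. -/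
theorem edgeThreshold_eq_sq_mul (α : Fin 4 → Fin 4 → Fin 4 → ℤ × ℤ × ℤ → ℝ) (νh : ℝ) :
    edgeThreshold α νh = νh ^ 2 * edgeThreshold α 1 := by
  unfold edgeThreshold; ring

/-- **The inertial-regime rate statement at `ν̂ = 1` gives it at every `ν̂ > 0`.**  If for every uniformly bounded admissible eternal solution
at covariant viscosity `1` and every tail bound `M > edgeThreshold α 1` at base shell `0` the next tail is `≤ (1+ε₀)^{-a} M`, then the same holds
at covariant viscosity `ν̂` with the threshold `edgeThreshold α ν̂` — the body of the open stub `stub_inertial` depends on `(ν̂, M)` only through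
`M/ν̂²`. -/
theorem inertialRateAt_of_one {a : ℝ} {α : Fin 4 → Fin 4 → Fin 4 → ℤ × ℤ × ℤ → ℝ}
    (H : ∀ W : ℤ → ℝ → Em 4, IsEternalVisc ε₀ 1 α W → UniformBound W → ∀ M : ℝ, edgeThreshold α 1 < M →
      (∀ σ : ℝ, ∑' k : ℕ, physEnergy ε₀ W (0 + k) σ ≤ M) →
      ∀ σ : ℝ, ∑' k : ℕ, physEnergy ε₀ W (0 + 1 + k) σ ≤ (1 + ε₀) ^ (-a) * M)
    {νh : ℝ} (hν : 0 < νh) (W : ℤ → ℝ → Em 4) (hW : IsEternalVisc ε₀ νh α W) (hU : UniformBound W)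
    (M : ℝ) (hM : edgeThreshold α νh < M) (hT : ∀ σ : ℝ, ∑' k : ℕ, physEnergy ε₀ W (0 + k) σ ≤ M) (σ : ℝ) :
    ∑' k : ℕ, physEnergy ε₀ W (0 + 1 + k) σ ≤ (1 + ε₀) ^ (-a) * M := by
  -- translate by `h = -log ν̂`: viscosity `e^h ν̂ = 1`, energies scaled by `e^{2h} = ν̂^{-2}`
  set h : ℝ := -Real.log νh with hh
  have heh : Real.exp h = νh⁻¹ := by rw [hh, Real.exp_neg, Real.exp_log hν]
  have he2h : Real.exp (2 * h) = (νh ^ 2)⁻¹ := by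
    rw [show 2 * h = h + h by ring, Real.exp_add, heh]; field_simp
  set W' : ℤ → ℝ → Em 4 := fun n τ => W n (τ - h) with hW'
  have hW'v : IsEternalVisc ε₀ 1 α W' := by
    have := hW.translate h
    rwa [heh, inv_mul_cancel₀ hν.ne'] at this
  have hU' : UniformBound W' := by
    obtain ⟨C, hC⟩ := hU; exact ⟨C, fun k τ => hC k (τ - h)⟩
  -- the tail bound and the threshold transport
  set M' : ℝ := (νh ^ 2)⁻¹ * M with hM'
  have hν2 : 0 < νh ^ 2 := pow_pos hν 2
  have hM'thr : edgeThreshold α 1 < M' := by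
    rw [hM', lt_inv_mul_iff₀ hν2, ← edgeThreshold_eq_sq_mul]
    exact hM
  have hT' : ∀ τ : ℝ, ∑' k : ℕ, physEnergy ε₀ W' (0 + k) τ ≤ M' := by
    intro τ
    rw [hW', tail_translate W h 0 τ, he2h, hM']
    exact mul_le_mul_of_nonneg_left (hT (τ - h)) (inv_nonneg.2 hν2.le)
  -- conclude for `W'` at `σ + h`, i.e. for `W` at `σ`
  have hc := H W' hW'v hU' M' hM'thr hT' (σ + h)
  rw [hW', tail_translate W h (0 + 1) (σ + h), add_sub_cancel_right, he2h, hM'] at hc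
  have hc' : (νh ^ 2)⁻¹ * ∑' k : ℕ, physEnergy ε₀ W (0 + 1 + k) σ ≤ (νh ^ 2)⁻¹ * ((1 + ε₀) ^ (-a) * M) := by
    calc (νh ^ 2)⁻¹ * ∑' k : ℕ, physEnergy ε₀ W (0 + 1 + k) σ ≤ (1 + ε₀) ^ (-a) * ((νh ^ 2)⁻¹ * M) := hc
      _ = (νh ^ 2)⁻¹ * ((1 + ε₀) ^ (-a) * M) := by ring
  exact le_of_mul_le_mul_left hc' (inv_pos.2 hν2)

/-- The same transport packaged on `RateAt` without threshold (all tail bounds): the rate statement at base shell `0` for `ν̂ = 1` gives it for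
every `ν̂ > 0`. -/
theorem rateAt_of_one {a : ℝ} {α : Fin 4 → Fin 4 → Fin 4 → ℤ × ℤ × ℤ → ℝ} (H : RateAt a ε₀ α 1 0)
    {νh : ℝ} (hν : 0 < νh) : RateAt a ε₀ α νh 0 := by
  intro W hW hU M hT σ
  set h : ℝ := -Real.log νh with hh
  have heh : Real.exp h = νh⁻¹ := by rw [hh, Real.exp_neg, Real.exp_log hν]
  have he2h : Real.exp (2 * h) = (νh ^ 2)⁻¹ := by
    rw [show 2 * h = h + h by ring, Real.exp_add, heh]; field_simp
  set W' : ℤ → ℝ → Em 4 := fun n τ => W n (τ - h) with hW'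
  have hW'v : IsEternalVisc ε₀ 1 α W' := by
    have := hW.translate h
    rwa [heh, inv_mul_cancel₀ hν.ne'] at this
  have hU' : UniformBound W' := by
    obtain ⟨C, hC⟩ := hU; exact ⟨C, fun k τ => hC k (τ - h)⟩
  have hν2 : 0 < νh ^ 2 := pow_pos hν 2
  have hT' : ∀ τ : ℝ, ∑' k : ℕ, physEnergy ε₀ W' (0 + k) τ ≤ (νh ^ 2)⁻¹ * M := by
    intro τ
    rw [hW', tail_translate W h 0 τ, he2h]
    exact mul_le_mul_of_nonneg_left (hT (τ - h)) (inv_nonneg.2 hν2.le)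
  have hc := H W' hW'v hU' ((νh ^ 2)⁻¹ * M) hT' (σ + h)
  rw [hW', tail_translate W h (0 + 1) (σ + h), add_sub_cancel_right, he2h] at hc
  have hc' : (νh ^ 2)⁻¹ * ∑' k : ℕ, physEnergy ε₀ W (0 + 1 + k) σ ≤ (νh ^ 2)⁻¹ * ((1 + ε₀) ^ (-a) * M) := by
    calc (νh ^ 2)⁻¹ * ∑' k : ℕ, physEnergy ε₀ W (0 + 1 + k) σ ≤ (1 + ε₀) ^ (-a) * ((νh ^ 2)⁻¹ * M) := hc
      _ = (νh ^ 2)⁻¹ * ((1 + ε₀) ^ (-a) * M) := by ring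
  exact le_of_mul_le_mul_left hc' (inv_pos.2 hν2)

end Summit.NavierStokesRegularity.NavierStokesRegularity.Cruxes.EternalViscousRate.DissipationEdge

end
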